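import Mathlib
import HarnessLib
import Literature.MathematicalPhysics.QuantumLattice.HubbardFermiRadiusBandContinuous

/-!
# Route `KLProgramme` — ENGINE crux `KLRegimeEngineV17F2` (stmt-HubbardSuperconductivity-20437), row (C) `stub_twoLeg_curvature`:
# the FREE band's polar Fermi radius on the first octant — monotonicity in the angle, the radial-slope floor and the
# polar-Jacobian ceiling at the axis point, `D₄` reduction (cell gate-hubbard-kl, seat p1b g19 = 20437 registrant lineage; 0 kit)

Supply file for `…PerturbedFermiCurveWindowJetsOrderZero` (the four ORDER-ZERO entries of the polar-jet table `klwjTableA` of the (C) closer's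
producer hypothesis `hcertA : KlwjCertA` as THEOREMS).  Square-lattice band `ε₀(k) = -2(cos k₁ + cos k₂)`, level function
`F(θ, t) = ε₀(t·dir θ)` (`rayDispersion`), radial slope `∂_tF` (`rayDispersionDt`), polar Fermi radius `u_μ(θ) = bandFermiRadius μ θ`
(`F(θ, u_μ(θ)) = μ`, `-4 < μ < 0`).  Everything here is generic in the level `μ ∈ (-4, 0)`; folklore.
* §1 `t ↦ t sin t / (1 - cos t)` is non-increasing on `(0, 2π)` (derivative `(sin t - t)/(1 - cos t) ≤ 0`), whence the CHORD inequality
  `A sin A (1 - cos x) ≤ x sin x (1 - cos A)` for `0 ≤ x ≤ A ≤ π` (the `sinc` comparison `x sin y ≤ y sin x`, `0 ≤ x ≤ y ≤ π`, is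
  proved inline from Mathlib's `strictConcaveOn_sin_Icc` — the same argument as `Literature.Geometry.Riemannian.mul_sin_le_mul_sin`,
  not imported so that this free-band chain does not rebuild with the Riemannian-geometry literature).
* §2 on the first octant `θ ∈ [0, π/4]`: `∂_θF = 2t(cos θ sin(t sin θ) - sin θ sin(t cos θ)) ≥ 0` (sinc), so `F(·, t)` is non-decreasing in
  `θ` (`rayDispersion_angle_mono`) and — `F(θ, ·)` being strictly increasing (`strictMonoOn_rayDispersion_band`) — **`u_μ` is non-increasing
  on `[0, π/4]`** (`bandFermiRadius_antitoneOn_octant`): `u_μ(π/4) ≤ u_μ(θ) ≤ u_μ(0) =: a₀`, `cos a₀ = -1 - μ/2`, `(2 sin a₀)² = -μ(4+μ)`.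
  KEY ESTIMATE `mul_rayDispersionDt_ge`: `u·∂_tF = ∇ε₀(k)·k = 2(k₁ sin k₁ + k₂ sin k₂) ≥ 2 a₀ sin a₀` — the chord inequality at
  `k₁, k₂ ≤ a₀` summed, with `(1 - cos k₁) + (1 - cos k₂) = 2 + μ/2 = 1 - cos a₀`.  Hence the RADIAL-SLOPE FLOOR **`∂_tF(θ, u_μ(θ)) ≥ 2 sin a₀`**
  (`two_sin_le_rayDispersionDt`) and the POLAR-JACOBIAN CEILING **`u/∂_tF ≤ q/d`** whenever `a₀ ≤ q`, `0 < d ≤ 2 sin a₀` (`bandFermiRadius_div_le`);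
  comparison lemmas `bandFermiRadius_le_of_le_rayDispersion` / `le_bandFermiRadius_of_rayDispersion_le` (`u ≤ q ⇐ μ ≤ F(θ, q)`, dually).
* §3 `exists_octant_angle`: every angle has a representative `θ' = arcsin (min |cos θ| |sin θ|) ∈ [0, π/4]` with the same `F(θ', ·)`, `∂_tF(θ', ·)`
  and `‖dir θ'‖` (they depend on `θ` only through `{|cos θ|, |sin θ|}`), so `u_μ(θ') = u_μ(θ)` by `bandFermiRadius_eq_of_forall_eq`.
Honest framing: elementary facts about the FREE dispersion; nothing here asserts row (C), any stub of 20437, K3, U₀, the window, a margin or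
superconductivity in the Hubbard model.
References: BGM 2006 §1 (1.4)–(1.5), §2.4 Lemma 2.1 (2.40) (polar description of the free Fermi curve) [cite: BenfattoGiulianiMastropietro2006].
-/

noncomputable section

namespace Summit.HubbardSuperconductivity.HubbardSuperconductivity.Theorems.PerturbedFermiCurve

set_option linter.dupNamespace false -- summit = problem name (single-conjunct summit), D-0017

open Real Set Literature.MathematicalPhysics.QuantumLattice

/-! ## §1 Two one-variable inequalities -/

/-- On `(0, 2π)` the cosine is `< 1`. -/
theorem one_sub_cos_pos_of_mem_Ioo {t : ℝ} (ht : t ∈ Ioo 0 (2 * π)) : 0 < 1 - Real.cos t := by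
  have hne : Real.cos t ≠ 1 := by
    intro h
    have := (Real.cos_eq_one_iff_of_lt_of_lt (by linarith [ht.1, Real.pi_pos]) ht.2).1 h
    linarith [ht.1]
  have := Real.cos_le_one t
  exact sub_pos.2 (lt_of_le_of_ne this hne)

/-- **The chord inequality**: `t ↦ t sin t / (1 - cos t)` is non-increasing on `(0, 2π)` (its derivative is
`(sin t - t)/(1 - cos t) ≤ 0`). -/
theorem mul_sin_div_antitoneOn :
    AntitoneOn (fun t : ℝ => t * Real.sin t / (1 - Real.cos t)) (Ioo 0 (2 * π)) := by
  have hd : ∀ t ∈ Ioo 0 (2 * π), HasDerivAt (fun t : ℝ => t * Real.sin t / (1 - Real.cos t))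
      (((1 * Real.sin t + t * Real.cos t) * (1 - Real.cos t) - t * Real.sin t * (0 - -Real.sin t)) / (1 - Real.cos t) ^ 2) t := by
    intro t ht
    have hden : (1 - Real.cos t) ≠ 0 := (one_sub_cos_pos_of_mem_Ioo ht).ne'
    exact (((hasDerivAt_id t).mul (Real.hasDerivAt_sin t)).div
      ((hasDerivAt_const t (1 : ℝ)).sub (Real.hasDerivAt_cos t)) hden)
  apply antitoneOn_of_deriv_nonpos (convex_Ioo 0 (2 * π))
  · exact fun t ht => (hd t ht).continuousAt.continuousWithinAt
  · rw [interior_Ioo]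
    exact fun t ht => (hd t ht).differentiableAt.differentiableWithinAt
  · rw [interior_Ioo]
    intro t ht
    rw [(hd t ht).deriv]
    have hpos := one_sub_cos_pos_of_mem_Ioo ht
    have hnum : ((1 * Real.sin t + t * Real.cos t) * (1 - Real.cos t) - t * Real.sin t * (0 - -Real.sin t)) =
        (Real.sin t - t) * (1 - Real.cos t) := by
      have := Real.sin_sq_add_cos_sq t
      linear_combination (-t) * this
    rw [hnum]
    apply div_nonpos_of_nonpos_of_nonneg _ (sq_nonneg _)
    have := Real.sin_le ht.1.le
    nlinarith

/-- **The chord inequality** in product form: for `0 ≤ x ≤ A ≤ π`,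
`A sin A (1 - cos x) ≤ x sin x (1 - cos A)`. -/
theorem chord_mul_sin_le {x A : ℝ} (hx : 0 ≤ x) (hxA : x ≤ A) (hA : A ≤ π) :
    A * Real.sin A * (1 - Real.cos x) ≤ x * Real.sin x * (1 - Real.cos A) := by
  rcases hx.eq_or_lt with rfl | hx0
  · simp
  rcases hA.eq_or_lt with rfl | hAπ
  · simp only [Real.sin_pi, mul_zero, zero_mul]
    have h1 : 0 ≤ Real.sin x := Real.sin_nonneg_of_nonneg_of_le_pi hx hxA
    have h2 : 0 ≤ 1 - Real.cos π := by rw [Real.cos_pi]; norm_num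
    positivity
  have hxI : x ∈ Ioo 0 (2 * π) := ⟨hx0, by linarith⟩
  have hAI : A ∈ Ioo 0 (2 * π) := ⟨hx0.trans_le hxA, by linarith⟩
  have h := mul_sin_div_antitoneOn hxI hAI hxA
  simp only at h
  rw [div_le_div_iff₀ (one_sub_cos_pos_of_mem_Ioo hAI) (one_sub_cos_pos_of_mem_Ioo hxI)] at h
  linarith

/-! ## §2 The first octant `θ ∈ [0, π/4]` -/

/-- On `[0, π/4]`: `0 ≤ sin θ ≤ cos θ` and `0 < cos θ`. -/
theorem octant_trig {θ : ℝ} (hθ : θ ∈ Icc 0 (π / 4)) :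
    0 ≤ Real.sin θ ∧ Real.sin θ ≤ Real.cos θ ∧ 0 < Real.cos θ := by
  have hπ := Real.pi_pos
  have hs : 0 ≤ Real.sin θ := Real.sin_nonneg_of_nonneg_of_le_pi hθ.1 (by linarith [hθ.2])
  have h1 : Real.sin θ ≤ Real.sin (π / 4) :=
    Real.sin_le_sin_of_le_of_le_pi_div_two (by linarith [hθ.1]) (by linarith [hθ.2]) hθ.2
  have h2 : Real.cos (π / 4) ≤ Real.cos θ :=
    Real.cos_le_cos_of_nonneg_of_le_pi hθ.1 (by linarith [hθ.2]) hθ.2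
  have hc : 0 < Real.cos θ := Real.cos_pos_of_mem_Ioo ⟨by linarith [hθ.1], by linarith [hθ.2]⟩
  rw [Real.sin_pi_div_four] at h1
  rw [Real.cos_pi_div_four] at h2
  exact ⟨hs, h1.trans h2, hc⟩

/-- On `[0, π/4]` the sup norm of the direction `dir θ = (cos θ, sin θ)` is `cos θ`. -/
theorem norm_dir_of_mem_octant {θ : ℝ} (hθ : θ ∈ Icc 0 (π / 4)) : ‖dir θ‖ = Real.cos θ := by
  obtain ⟨hs, hsc, hc⟩ := octant_trig hθ
  rw [norm_dir, abs_of_pos hc, abs_of_nonneg hs, max_eq_left hsc]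

/-- **The level function `F(θ, t) = ε₀(t·dir θ)` is non-decreasing in the angle on the first octant** at fixed radius
`t ≥ 0` with `t cos θ₁ ≤ π`: `∂_θ F = 2t (cos θ sin(t sin θ) - sin θ sin(t cos θ)) ≥ 0` by the `sinc` comparison
(`t sin θ ≤ t cos θ ≤ π`). -/
theorem rayDispersion_angle_mono {θ₁ θ₂ t : ℝ} (h1 : 0 ≤ θ₁) (h12 : θ₁ ≤ θ₂) (h2 : θ₂ ≤ π / 4)
    (ht : 0 ≤ t) (htπ : t * Real.cos θ₁ ≤ π) :
    rayDispersion (θ₁, t) ≤ rayDispersion (θ₂, t) := by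
  have hmono : MonotoneOn (fun ϑ => rayDispersion (ϑ, t)) (Icc θ₁ θ₂) := by
    apply monotoneOn_of_deriv_nonneg (convex_Icc θ₁ θ₂)
    · exact fun ϑ _ => (hasDerivAt_rayDispersion_angle ϑ t).continuousAt.continuousWithinAt
    · exact fun ϑ _ => (hasDerivAt_rayDispersion_angle ϑ t).differentiableAt.differentiableWithinAt
    · intro ϑ hϑ
      rw [interior_Icc] at hϑ
      rw [(hasDerivAt_rayDispersion_angle ϑ t).deriv, rayDispersionDθ]
      have hϑI : ϑ ∈ Icc 0 (π / 4) := ⟨h1.trans hϑ.1.le, hϑ.2.le.trans h2⟩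
      obtain ⟨hs, hsc, hc⟩ := octant_trig hϑI
      have hcos : Real.cos ϑ ≤ Real.cos θ₁ :=
        Real.cos_le_cos_of_nonneg_of_le_pi h1 (by linarith [hϑ.2, h2, Real.pi_pos]) hϑ.1.le
      have hx : 0 ≤ t * Real.sin ϑ := mul_nonneg ht hs
      have hxy : t * Real.sin ϑ ≤ t * Real.cos ϑ := mul_le_mul_of_nonneg_left hsc ht
      have hy : t * Real.cos ϑ ≤ π := (mul_le_mul_of_nonneg_left hcos ht).trans htπ
      -- the `sinc` comparison `x sin y ≤ y sin x` (`0 ≤ x ≤ y ≤ π`) from the concavity of `sin` on `[0, π]`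
      have key : t * Real.sin ϑ * Real.sin (t * Real.cos ϑ) ≤ t * Real.cos ϑ * Real.sin (t * Real.sin ϑ) := by
        rcases hx.eq_or_lt with hx0 | hx0
        · rw [← hx0]; simp
        have hy0 : 0 < t * Real.cos ϑ := hx0.trans_le hxy
        have hconc := strictConcaveOn_sin_Icc.concaveOn
        have h := hconc.2 (show t * Real.cos ϑ ∈ Icc 0 π from ⟨hy0.le, hy⟩) (show (0 : ℝ) ∈ Icc 0 π from ⟨le_rfl, Real.pi_pos.le⟩)
          (show 0 ≤ t * Real.sin ϑ / (t * Real.cos ϑ) from div_nonneg hx hy0.le)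
          (show 0 ≤ 1 - t * Real.sin ϑ / (t * Real.cos ϑ) by rw [sub_nonneg]; exact div_le_one_of_le₀ hxy hy0.le) (by ring)
        simp only [smul_eq_mul, mul_zero, add_zero, Real.sin_zero] at h
        rw [div_mul_cancel₀ _ hy0.ne'] at h
        -- `h : (x / y) * sin y ≤ sin x` with `x = t sin ϑ`, `y = t cos ϑ`
        have h' : t * Real.sin ϑ * Real.sin (t * Real.cos ϑ) = (t * Real.cos ϑ) * (t * Real.sin ϑ / (t * Real.cos ϑ) * Real.sin (t * Real.cos ϑ)) := by
          field_simp
        rw [h']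
        exact mul_le_mul_of_nonneg_left h hy0.le
      nlinarith [key]
  exact hmono ⟨le_rfl, h12⟩ ⟨h12, le_rfl⟩ h12

section Band

variable {μ : ℝ} (hμ₁ : -4 < μ) (hμ₂ : μ < 0)
include hμ₁ hμ₂

/-- **The free Fermi radius is non-increasing in the angle on the first octant** (`-4 < μ < 0`): for
`0 ≤ θ₁ ≤ θ₂ ≤ π/4`, `u_μ(θ₂) ≤ u_μ(θ₁)` — the Fermi curve is closest to `Γ` along the zone diagonal and farthest along the axes. -/
theorem bandFermiRadius_antitoneOn_octant : AntitoneOn (bandFermiRadius μ) (Icc 0 (π / 4)) := by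
  intro θ₁ hθ₁ θ₂ hθ₂ h12
  by_contra hlt
  have hlt := lt_of_not_ge hlt
  have hu1 := isBandFermiRadius_bandFermiRadius hμ₁ hμ₂ θ₁
  have hu2 := isBandFermiRadius_bandFermiRadius hμ₁ hμ₂ θ₂
  have hmem2 := hu2.mem_Icc
  have hmem1 : bandFermiRadius μ θ₁ ∈ Icc 0 (π / ‖dir θ₂‖) := ⟨hu1.1.1, hlt.le.trans hmem2.2⟩
  have hsm := strictMonoOn_rayDispersion_band θ₂ hmem1 hmem2 hlt
  simp only at hsm
  rw [hu2.2] at hsm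
  have hle := rayDispersion_angle_mono hθ₁.1 h12 hθ₂.2 hu1.1.1
    (by rw [← norm_dir_of_mem_octant hθ₁]; exact hu1.1.2)
  rw [hu1.2] at hle
  linarith

/-- On the first octant `u_μ(θ) ≤ u_μ(0)`. -/
theorem bandFermiRadius_le_zero {θ : ℝ} (hθ : θ ∈ Icc 0 (π / 4)) : bandFermiRadius μ θ ≤ bandFermiRadius μ 0 :=
  bandFermiRadius_antitoneOn_octant hμ₁ hμ₂ ⟨le_rfl, by positivity⟩ hθ hθ.1

/-- On the first octant `u_μ(π/4) ≤ u_μ(θ)`. -/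
theorem bandFermiRadius_pi_div_four_le {θ : ℝ} (hθ : θ ∈ Icc 0 (π / 4)) :
    bandFermiRadius μ (π / 4) ≤ bandFermiRadius μ θ :=
  bandFermiRadius_antitoneOn_octant hμ₁ hμ₂ hθ ⟨by positivity, le_rfl⟩ hθ.2

/-- Comparison from above: `u_μ(θ) ≤ q` as soon as `μ ≤ F(θ, q)` (`0 ≤ q`, `q‖dir θ‖ ≤ π`). -/
theorem bandFermiRadius_le_of_le_rayDispersion {θ q : ℝ} (hq0 : 0 ≤ q) (hq : q * ‖dir θ‖ ≤ π)
    (h : μ ≤ rayDispersion (θ, q)) : bandFermiRadius μ θ ≤ q := by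
  have hu := isBandFermiRadius_bandFermiRadius hμ₁ hμ₂ θ
  have hqI : q ∈ Icc 0 (π / ‖dir θ‖) := ⟨hq0, by rw [le_div_iff₀ (norm_dir_pos θ)]; exact hq⟩
  rw [← (strictMonoOn_rayDispersion_band θ).le_iff_le hu.mem_Icc hqI, hu.2]
  exact h

/-- Comparison from below: `q ≤ u_μ(θ)` as soon as `F(θ, q) ≤ μ` (`0 ≤ q`, `q‖dir θ‖ ≤ π`). -/
theorem le_bandFermiRadius_of_rayDispersion_le {θ q : ℝ} (hq0 : 0 ≤ q) (hq : q * ‖dir θ‖ ≤ π)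
    (h : rayDispersion (θ, q) ≤ μ) : q ≤ bandFermiRadius μ θ := by
  have hu := isBandFermiRadius_bandFermiRadius hμ₁ hμ₂ θ
  have hqI : q ∈ Icc 0 (π / ‖dir θ‖) := ⟨hq0, by rw [le_div_iff₀ (norm_dir_pos θ)]; exact hq⟩
  rw [← (strictMonoOn_rayDispersion_band θ).le_iff_le hqI hu.mem_Icc, hu.2]
  exact h

/-- `cos u_μ(0) = -1 - μ/2` (the axis point `(u_μ(0), 0)` of the Fermi curve). -/
theorem cos_bandFermiRadius_zero : Real.cos (bandFermiRadius μ 0) = -1 - μ / 2 := by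
  have h := rayDispersion_bandFermiRadius hμ₁ hμ₂ 0
  rw [rayDispersion_eq] at h
  simp only [Real.cos_zero, Real.sin_zero, mul_one, mul_zero] at h
  linarith

/-- `u_μ(0) < π`. -/
theorem bandFermiRadius_zero_lt_pi : bandFermiRadius μ 0 < π := by
  have h := bandFermiRadius_lt_exit hμ₁ hμ₂ 0
  have h1 : ‖dir (0 : ℝ)‖ = 1 := by
    rw [norm_dir, Real.cos_zero, Real.sin_zero, abs_one, abs_zero, max_eq_left zero_le_one]
  rwa [h1, div_one] at h

/-- `(2 sin u_μ(0))² = -μ(4 + μ)`: the squared radial slope at the axis point. -/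
theorem sq_two_sin_bandFermiRadius_zero : (2 * Real.sin (bandFermiRadius μ 0)) ^ 2 = -μ * (4 + μ) := by
  have h := Real.sin_sq_add_cos_sq (bandFermiRadius μ 0)
  rw [cos_bandFermiRadius_zero hμ₁ hμ₂] at h
  linear_combination 4 * h

/-- `0 ≤ sin u_μ(0)`. -/
theorem sin_bandFermiRadius_zero_nonneg : 0 ≤ Real.sin (bandFermiRadius μ 0) :=
  Real.sin_nonneg_of_nonneg_of_le_pi (bandFermiRadius_pos hμ₁ hμ₂ 0).le (bandFermiRadius_zero_lt_pi hμ₁ hμ₂).le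

/-- The level equation in coordinates: `cos k₁ + cos k₂ = -μ/2` at `k = u_μ(θ)·dir θ`. -/
theorem cos_add_cos_bandFermiRadius (θ : ℝ) :
    Real.cos (bandFermiRadius μ θ * Real.cos θ) + Real.cos (bandFermiRadius μ θ * Real.sin θ) = -μ / 2 := by
  have h := rayDispersion_bandFermiRadius hμ₁ hμ₂ θ
  rw [rayDispersion_eq] at h
  simp only at h
  linarith

omit hμ₁ hμ₂ in
/-- `t·∂_tF(θ, t) = 2 (k₁ sin k₁ + k₂ sin k₂)` with `k = t·dir θ` (`= ∇ε₀(k)·k`). -/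
theorem mul_rayDispersionDt_eq (θ t : ℝ) :
    t * rayDispersionDt θ t =
      2 * ((t * Real.cos θ) * Real.sin (t * Real.cos θ) + (t * Real.sin θ) * Real.sin (t * Real.sin θ)) := by
  rw [rayDispersionDt]; ring

/-- **KEY ESTIMATE** (first octant): `2 u_μ(0) sin u_μ(0) ≤ u_μ(θ)·∂_tF(θ, u_μ(θ))` — i.e. `∇ε₀(k)·k` on the Fermi curve is
minimal at the axis point.  Proof: the chord inequality for the concave-in-`cos` function `k sin k` at the two coordinates
`k₁, k₂ ≤ u_μ(0)`, summed, with `(1 - cos k₁) + (1 - cos k₂) = 2 + μ/2 = 1 - cos u_μ(0)`. -/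
theorem mul_rayDispersionDt_ge {θ : ℝ} (hθ : θ ∈ Icc 0 (π / 4)) :
    2 * (bandFermiRadius μ 0 * Real.sin (bandFermiRadius μ 0)) ≤
      bandFermiRadius μ θ * rayDispersionDt θ (bandFermiRadius μ θ) := by
  obtain ⟨hs, hsc, hc⟩ := octant_trig hθ
  set a₀ := bandFermiRadius μ 0 with ha₀
  set u := bandFermiRadius μ θ with hu
  have hu0 : 0 < u := bandFermiRadius_pos hμ₁ hμ₂ θ
  have hua : u ≤ a₀ := bandFermiRadius_le_zero hμ₁ hμ₂ hθ
  have haπ : a₀ < π := bandFermiRadius_zero_lt_pi hμ₁ hμ₂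
  have hca : Real.cos a₀ = -1 - μ / 2 := cos_bandFermiRadius_zero hμ₁ hμ₂
  have hk := cos_add_cos_bandFermiRadius hμ₁ hμ₂ θ
  have hk1 : 0 ≤ u * Real.cos θ := by positivity
  have hk2 : 0 ≤ u * Real.sin θ := mul_nonneg hu0.le hs
  have hk1a : u * Real.cos θ ≤ a₀ := by nlinarith [Real.cos_le_one θ]
  have hk2a : u * Real.sin θ ≤ a₀ := by nlinarith
  have c1 := chord_mul_sin_le hk1 hk1a haπ.le
  have c2 := chord_mul_sin_le hk2 hk2a haπ.le
  have hpos : 0 < 1 - Real.cos a₀ := by rw [hca]; linarith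
  have hid : (1 - Real.cos (u * Real.cos θ)) + (1 - Real.cos (u * Real.sin θ)) = 1 - Real.cos a₀ := by
    rw [hca]; linarith
  rw [mul_rayDispersionDt_eq]
  have hsum : 2 * (a₀ * Real.sin a₀) * (1 - Real.cos a₀) ≤
      2 * ((u * Real.cos θ) * Real.sin (u * Real.cos θ) + (u * Real.sin θ) * Real.sin (u * Real.sin θ)) *
        (1 - Real.cos a₀) := by
    calc 2 * (a₀ * Real.sin a₀) * (1 - Real.cos a₀)
        = 2 * (a₀ * Real.sin a₀ * (1 - Real.cos (u * Real.cos θ)) + a₀ * Real.sin a₀ * (1 - Real.cos (u * Real.sin θ))) := by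
          rw [← hid]; ring
      _ ≤ 2 * ((u * Real.cos θ) * Real.sin (u * Real.cos θ) * (1 - Real.cos a₀) +
            (u * Real.sin θ) * Real.sin (u * Real.sin θ) * (1 - Real.cos a₀)) := by linarith [c1, c2]
      _ = _ := by ring
  exact le_of_mul_le_mul_right hsum hpos

/-- **RADIAL-SLOPE FLOOR** (first octant): `2 sin u_μ(0) ≤ ∂_tF(θ, u_μ(θ))` (`(2 sin u_μ(0))² = -μ(4+μ)`). -/
theorem two_sin_le_rayDispersionDt {θ : ℝ} (hθ : θ ∈ Icc 0 (π / 4)) :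
    2 * Real.sin (bandFermiRadius μ 0) ≤ rayDispersionDt θ (bandFermiRadius μ θ) := by
  have key := mul_rayDispersionDt_ge hμ₁ hμ₂ hθ
  have hu0 : 0 < bandFermiRadius μ θ := bandFermiRadius_pos hμ₁ hμ₂ θ
  have hua := bandFermiRadius_le_zero hμ₁ hμ₂ hθ
  have hsin := sin_bandFermiRadius_zero_nonneg hμ₁ hμ₂
  by_contra h
  have h := lt_of_not_ge h
  have h1 := mul_lt_mul_of_pos_left h hu0
  nlinarith

/-- **POLAR-JACOBIAN CEILING** (first octant): if `u_μ(0) ≤ q` and `0 < d ≤ 2 sin u_μ(0)` then `u/∂_tF ≤ q/d` at `(θ, u_μ(θ))`. -/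
theorem bandFermiRadius_div_le {θ : ℝ} (hθ : θ ∈ Icc 0 (π / 4)) {q d : ℝ} (hq : bandFermiRadius μ 0 ≤ q) (hd0 : 0 < d)
    (hd : d ≤ 2 * Real.sin (bandFermiRadius μ 0)) :
    bandFermiRadius μ θ / rayDispersionDt θ (bandFermiRadius μ θ) ≤ q / d := by
  have key := mul_rayDispersionDt_ge hμ₁ hμ₂ hθ
  set a₀ := bandFermiRadius μ 0
  set u := bandFermiRadius μ θ
  set D := rayDispersionDt θ u
  have hu0 : 0 < u := bandFermiRadius_pos hμ₁ hμ₂ θ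
  have hua : u ≤ a₀ := bandFermiRadius_le_zero hμ₁ hμ₂ hθ
  have hD : 0 < D := rayDispersionDt_bandFermiRadius_pos hμ₁ hμ₂ θ
  rw [div_le_div_iff₀ hD hd0]
  have hd' : 0 ≤ 2 * Real.sin a₀ := hd0.le.trans hd
  -- u·(u·2 sin a₀) ≤ a₀·(u D)
  have h1 : u * (u * (2 * Real.sin a₀)) ≤ u * (a₀ * D) := by
    have : u * u * (2 * Real.sin a₀) ≤ a₀ * a₀ * (2 * Real.sin a₀) :=
      mul_le_mul_of_nonneg_right (mul_le_mul hua hua hu0.le (hu0.le.trans hua)) hd'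
    nlinarith [key, this]
  have h2 : u * (2 * Real.sin a₀) ≤ a₀ * D := le_of_mul_le_mul_left h1 hu0
  calc u * d ≤ u * (2 * Real.sin a₀) := mul_le_mul_of_nonneg_left hd hu0.le
    _ ≤ a₀ * D := h2
    _ ≤ q * D := mul_le_mul_of_nonneg_right hq hD.le

end Band

/-! ## §3 Symmetry reduction to the first octant -/

/-- `cos (t c) = cos (t |c|)`. -/
theorem cos_mul_abs (t c : ℝ) : Real.cos (t * |c|) = Real.cos (t * c) := by
  rcases le_total 0 c with h | h
  · rw [abs_of_nonneg h]
  · rw [abs_of_nonpos h, mul_neg, Real.cos_neg]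

/-- `|c| sin (t |c|) = c sin (t c)`. -/
theorem abs_mul_sin_mul_abs (t c : ℝ) : |c| * Real.sin (t * |c|) = c * Real.sin (t * c) := by
  rcases le_total 0 c with h | h
  · rw [abs_of_nonneg h]
  · rw [abs_of_nonpos h, mul_neg, Real.sin_neg]; ring

/-- **Symmetry reduction.**  For every angle `θ` there is `θ' ∈ [0, π/4]` (namely `arcsin (min |cos θ| |sin θ|)`) with the
same level function `F(θ', ·) = F(θ, ·)`, the same radial slope `∂_tF(θ', ·) = ∂_tF(θ, ·)` and the same sup norm
`‖dir θ'‖ = ‖dir θ‖` (the `D₄` symmetry of `ε₀`: both depend on `θ` only through `{|cos θ|, |sin θ|}`). -/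
theorem exists_octant_angle (θ : ℝ) : ∃ θ' ∈ Icc 0 (π / 4),
    (∀ t, rayDispersion (θ', t) = rayDispersion (θ, t)) ∧ (∀ t, rayDispersionDt θ' t = rayDispersionDt θ t) ∧
      ‖dir θ'‖ = ‖dir θ‖ := by
  set m := min |Real.cos θ| |Real.sin θ| with hm
  set M := max |Real.cos θ| |Real.sin θ| with hM
  have hm0 : 0 ≤ m := le_min (abs_nonneg _) (abs_nonneg _)
  have hmM : m ≤ M := min_le_max
  have hM0 : 0 ≤ M := hm0.trans hmM
  have hcs := Real.cos_sq_add_sin_sq θ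
  have hsq : m ^ 2 + M ^ 2 = 1 := by
    rcases le_total |Real.cos θ| |Real.sin θ| with h1 | h1
    · rw [hm, hM, min_eq_left h1, max_eq_right h1, sq_abs, sq_abs]; exact hcs
    · rw [hm, hM, min_eq_right h1, max_eq_left h1, sq_abs, sq_abs]; linarith
  have hm1 : m ≤ 1 := by nlinarith
  have hm2 : m ≤ Real.sqrt 2 / 2 := by
    have h2 : m ^ 2 ≤ (Real.sqrt 2 / 2) ^ 2 := by
      rw [div_pow, Real.sq_sqrt (by norm_num : (0 : ℝ) ≤ 2)]; nlinarith
    exact (pow_le_pow_iff_left₀ hm0 (by positivity) two_ne_zero).1 h2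
  have hsin : Real.sin (Real.arcsin m) = m := Real.sin_arcsin (by linarith) hm1
  have hcos : Real.cos (Real.arcsin m) = M := by
    rw [Real.cos_arcsin]
    have : 1 - m ^ 2 = M ^ 2 := by linarith
    rw [this, Real.sqrt_sq hM0]
  -- the unordered pair `{|cos θ|, |sin θ|} = {M, m}`
  have hpair : ∀ f : ℝ → ℝ, f |Real.cos θ| + f |Real.sin θ| = f M + f m := by
    intro f
    rcases le_total |Real.cos θ| |Real.sin θ| with h1 | h1
    · rw [hm, hM, min_eq_left h1, max_eq_right h1, add_comm]
    · rw [hm, hM, min_eq_right h1, max_eq_left h1]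
  refine ⟨Real.arcsin m, ⟨Real.arcsin_nonneg.2 hm0, ?_⟩, ?_, ?_, ?_⟩
  · rw [Real.arcsin_le_iff_le_sin ⟨by linarith, hm1⟩ ⟨by linarith [Real.pi_pos], by linarith [Real.pi_pos]⟩,
      Real.sin_pi_div_four]
    exact hm2
  · intro t
    rw [rayDispersion_eq, rayDispersion_eq]
    simp only [hsin, hcos]
    rw [← cos_mul_abs t (Real.cos θ), ← cos_mul_abs t (Real.sin θ), hpair (fun x => Real.cos (t * x))]
  · intro t
    rw [rayDispersionDt, rayDispersionDt, hsin, hcos, ← abs_mul_sin_mul_abs t (Real.cos θ),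
      ← abs_mul_sin_mul_abs t (Real.sin θ), hpair (fun x => x * Real.sin (t * x))]
  · rw [norm_dir, norm_dir, hsin, hcos, abs_of_nonneg hM0, abs_of_nonneg hm0, ← hM, max_eq_left hmM]

end Summit.HubbardSuperconductivity.HubbardSuperconductivity.Theorems.PerturbedFermiCurve
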